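import Summits.HodgeConjecture.HodgeConjecture.Theorems.HodgeLocusCensusInclusionRankBetti

/-!
# Hodge locus census — the modular homology of the `q`-ladder at every codegree (PROBE 29)

certified instances and evidence bearing on the general Hodge conjecture; no claim.  Theorem-only helper sheet of the
unit-column line (gen 31's `…ModelNonJumpC1All` (`colR`), anchors 222 `…UnitColumnRankLevels`, 229 `…UnitColumnRankLevelsPowers`,
293 `…InclusionRankComplement`, 294 `…UnitColumnRankLevelsWilson`, 304 `…UnitColumnRankDrop`, 340 `…UnitColumnRankDropExact` (PROBE 27),
345 `…InclusionRankBetti` (PROBE 28)); nothing here is a statement about Hodge loci.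

WHAT.  `q = Σᵢ xᵢ^{e+1}` acts on the truncated algebra `K[x₁,…,x_k]/(xᵢ^{e+2})`, `K` a field of prime characteristic `p`; anchor 229's
multiplicity matrix of `×q^c` from codegree `J + c(e+1)` to codegree `J` has rows the monomials of codegree `J` and is, after anchor 222's
sorting by labels `μ = v mod (e+1)` (off the value `e+1`), a direct sum over the labels feasible at `J` of `c! ·` inclusion blocks
`W_{t,t+c}` on the `m = k − s` coordinates where `μ` vanishes (`s = #{μ ≠ 0}`, `t = (J+Σμ)/(e+1) − s`).  Since `q^p = Σᵢ xᵢ^{p(e+1)}`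
kills everything of use here, the `q`-LADDER `… → (codegree j) → (codegree J) → (codegree J + c(e+1)) → …`, `J = j + (p−c)(e+1)`, row
vectors times the matrices of `×q^(p−c)` and `×q^c`, has `im ⊆ ker` blockwise (PROBE 28 (B-cx)); PROBE 27 (EX) proved `dim ker = dim im` below
the middle.  THIS SHEET computes the difference at EVERY codegree, with no level hypothesis at all:

  (CENSUS BETTI)  `dim leftker(×q^c at J) − dim rowspace(×q^(p−c) at j) = Σ_μ [μ feasible at J ∧ block in its window] (S_p(k−s, t) − S_p(k−s, t+c))`,

window `2t ≤ (k−s) + (p−c) ∧ k−s < 2t + c`, `S_p(m, x) = Σ_{0 ≤ y ≤ m, y ≡ x (mod p)} C(m, y)` the `p`-section of the binomial row written in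
pieces `Σ_{b<x/p} C(m, x−(b+1)p) + C(m, x) + Σ_{b<(m−x)/p} C(m, x+(b+1)p)` — typed over `ℕ` as `dim leftker + Σ_μ[…] S_p(k−s,t+c) = dim rowspace +
Σ_μ[…] S_p(k−s,t)`.  Every label contributes `≥ 0` (PROBE 28), a label off its window contributes `0` (PROBE 27 (EX-W) below the window and,
with `(c, p−c)` exchanged at the complement block, beyond it), so the modular Betti number of the census ladder at `J` is the number of
windowed labels weighted by section differences; at a codegree with no feasible label in its window it is `0` (this contains PROBE 27 (EX)).
The one-block input is PROBE 28 §3 (BLOCK LAW), for ANY `m, t`: `OUT + IN + [window]·S_p(m,t) = C(m,t) + [window]·S_p(m,t+c)` with `OUT`, `IN`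
anchor 294's three-branch block values of `(t → t+c)` and `(t−(p−c) → t)`.
* §1 (ROWS) `#{monomials of codegree a} = Σ_μ [feasible] C(k−s, t)` (anchor 222's fibre bijection `exists_fiberEquiv`, `fiber_arith`);
  (IN-SUMMAND) anchor 294's summand of `×q^(p−c)` at `j`, re-read at `J = j + (p−c)(e+1)`, is the in-block value of the label (`t ↦ t − (p−c)`,
  same `s`, same `k − s`); (LABEL LAW) = (BLOCK LAW) per label, `0 = 0` for an infeasible one.
* §2 (CENSUS BETTI) rank–nullity for `×q^c` at `J` (`#rows` by (ROWS)), `dim rowspace = rank` for `×q^(p−c)` at `j`, anchor 294's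
  `rank_mulDeltaPow_levels_eq_sum_wilson` for both ranks (`c!`, `(p−c)!` are units since `c, p−c < p`), and the label sum of (LABEL LAW).
The census-level product `(×q^(p−c)) · (×q^c) = 0` is not typed here (blockwise it is PROBE 28 (B-cx)); the theorem is the dimension identity.

WHERE IT STANDS (context only; nothing imported or minted).  Blockwise this is the `G = 1` case of V. B. Mnukhin & J. Siemons, J. Combin.
Theory Ser. A 74 (1996) 287–300, doi:10.1006/jcta.1996.0051, Thm 5.3 («almost `p`-exact» inclusion sequences, one middle term); the census
statement is its direct sum over anchor 222's labels, whose blocks sit at different distances from their middles, so that at a fixed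
codegree some labels are exact and some are in their window — the sum is new bookkeeping, not new mathematics, and no literature fact is
used as a hypothesis.

NUMERICS FIRST (owner, file-backed; `gen57/probe29/`): (C1) ACTUAL census `0/1` matrices `N_c(J)`, `N_(p−c)(j)` (`M_c = c!·N_c`) over
`GF(p)` for small `k, e` and ALL `j`: `#rows(J) − rank N_c(J) − rank N_(p−c)(j)` = the windowed label sum, and `N_(p−c)(j) · N_c(J) ≡ 0 (mod p)`;
(C2) the same identity on anchor 304's closed forms (`rank_p = THEOREM L − (DROP′)`) for `p ≤ 11`, all `0 < c < p`, `e ≤ 5`, all `j` —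
0 violations.  Instance counts are in the READY line.
-/

set_option linter.dupNamespace false
set_option autoImplicit false

namespace Summit.HodgeConjecture.HodgeConjecture.HodgeLocus.Census.UnitColumnBetti

open Summit.HodgeConjecture.HodgeConjecture.HodgeLocus.Census.InclusionRankBetti (block_law)
open Summit.HodgeConjecture.HodgeConjecture.HodgeLocus.Census.ModelNonJumpC1All (colR)
open Summit.HodgeConjecture.HodgeConjecture.HodgeLocus.Census.UnitColumnRankLevels (exists_fiberEquiv fiber_arith)
open Summit.HodgeConjecture.HodgeConjecture.HodgeLocus.Census.UnitColumnRankLevelsWilson (rank_mulDeltaPow_levels_eq_sum_wilson card_zero_eq)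
open Summit.HodgeConjecture.HodgeConjecture.HodgeLocus.Census.InclusionRankComplement (cast_factorial_ne_zero)

/-! ## §1 rows and labels -/

/-- **(ROWS)** the number of monomials of codegree `a` is the label sum `Σ_μ [e+1 ∣ a+Σμ ∧ (e+1)s ≤ a+Σμ] C(k−s, (a+Σμ)/(e+1) − s)` (anchor 222's
fibres: the fibre of a feasible label is in bijection with the `t`-subsets of its `k − s` zero coordinates, `exists_fiberEquiv`; an infeasible
label has no rows, `fiber_arith`). -/
theorem card_eq_sum (k e a : ℕ) :
    Fintype.card {v : Fin k → Fin (e + 2) // (∑ i, (v i : ℕ)) + a = k * (e + 1)} =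
      ∑ μ : Fin k → Fin (e + 1),
        (if (e + 1) ∣ (a + ∑ i, (μ i : ℕ)) ∧
          (e + 1) * (Finset.univ.filter (fun l => (μ l : ℕ) ≠ 0)).card ≤ a + ∑ i, (μ i : ℕ) then
          (k - (Finset.univ.filter (fun l => (μ l : ℕ) ≠ 0)).card).choose
            ((a + ∑ i, (μ i : ℕ)) / (e + 1) - (Finset.univ.filter (fun l => (μ l : ℕ) ≠ 0)).card)
        else 0) := by
  classical
  rw [← Fintype.card_congr (Equiv.sigmaFiberEquiv (fun (v : {v : Fin k → Fin (e + 2) // (∑ i, (v i : ℕ)) + a = k * (e + 1)}) (l : Fin k) =>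
    (⟨(v.1 l : ℕ) % (e + 1), Nat.mod_lt _ (Nat.succ_pos e)⟩ : Fin (e + 1)))), Fintype.card_sigma]
  refine Finset.sum_congr rfl (fun μ _ => ?_)
  have hiff : ∀ w : Fin k → Fin (e + 2), ((fun l => (⟨(w l : ℕ) % (e + 1), Nat.mod_lt _ (Nat.succ_pos e)⟩ : Fin (e + 1))) = μ) ↔
      ∀ l, (w l : ℕ) % (e + 1) = (μ l : ℕ) := fun w =>
    ⟨fun h l => Fin.ext_iff.mp (congrFun h l), fun h => funext fun l => Fin.ext (h l)⟩
  rw [Fintype.card_congr (Equiv.subtypeEquivRight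
    (fun (v : {v : Fin k → Fin (e + 2) // (∑ i, (v i : ℕ)) + a = k * (e + 1)}) => hiff v.1))]
  by_cases hf : (e + 1) ∣ (a + ∑ i, (μ i : ℕ)) ∧ (e + 1) * (Finset.univ.filter (fun l => (μ l : ℕ) ≠ 0)).card ≤ a + ∑ i, (μ i : ℕ)
  · rw [if_pos hf]
    obtain ⟨⟨A, hA⟩, hle⟩ := hf
    rw [hA] at hle
    have hS : (Finset.univ.filter (fun l => (μ l : ℕ) ≠ 0)).card ≤ A := Nat.le_of_mul_le_mul_left hle (Nat.succ_pos e)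
    obtain ⟨eqv, -⟩ := exists_fiberEquiv μ a (A - (Finset.univ.filter (fun l => (μ l : ℕ) ≠ 0)).card) (by rw [Nat.sub_add_cancel hS]; exact hA)
    rw [Fintype.card_congr eqv, Fintype.card_finset_len, card_zero_eq k e μ, hA, Nat.mul_div_cancel_left A (Nat.succ_pos e)]
  · rw [if_neg hf, Fintype.card_eq_zero_iff]
    exact ⟨fun r => hf (by
      have h1 := fiber_arith μ r.1.1 r.1.2 r.2
      exact ⟨⟨_, h1⟩, by rw [h1]; exact Nat.mul_le_mul_left _ (Nat.le_add_left _ _)⟩)⟩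

/-- (IN-SUMMAND) anchor 294's summand of `×q^(p−c)` at codegree `j` for the label `μ`, rewritten at codegree `J = j + (p−c)(e+1)`:
it is the block `(t − (p−c) → t)` on `k − s` points when `μ` is feasible at `J` with `p − c ≤ t`, `t = (J+Σμ)/(e+1) − s`, and `0` otherwise. -/
theorem in_summand_eq (p k e c j : ℕ) (μ : Fin k → Fin (e + 1)) (hcp : c < p) :
    (if (e + 1) ∣ (j + ∑ i, (μ i : ℕ)) ∧
      (e + 1) * (Finset.univ.filter (fun l => (μ l : ℕ) ≠ 0)).card ≤ j + ∑ i, (μ i : ℕ) then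
      (if k - (Finset.univ.filter (fun l => (μ l : ℕ) ≠ 0)).card <
          ((j + ∑ i, (μ i : ℕ)) / (e + 1) - (Finset.univ.filter (fun l => (μ l : ℕ) ≠ 0)).card) + (p - c) then 0
       else if ((j + ∑ i, (μ i : ℕ)) / (e + 1) - (Finset.univ.filter (fun l => (μ l : ℕ) ≠ 0)).card) +
          (((j + ∑ i, (μ i : ℕ)) / (e + 1) - (Finset.univ.filter (fun l => (μ l : ℕ) ≠ 0)).card) + (p - c)) ≤
          k - (Finset.univ.filter (fun l => (μ l : ℕ) ≠ 0)).card then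
         ∑ i ∈ Finset.range (((j + ∑ i, (μ i : ℕ)) / (e + 1) - (Finset.univ.filter (fun l => (μ l : ℕ) ≠ 0)).card) + 1),
           if p ∣ (((j + ∑ i, (μ i : ℕ)) / (e + 1) - (Finset.univ.filter (fun l => (μ l : ℕ) ≠ 0)).card) + (p - c) - i).choose
               (((j + ∑ i, (μ i : ℕ)) / (e + 1) - (Finset.univ.filter (fun l => (μ l : ℕ) ≠ 0)).card) - i) then 0
           else ((k - (Finset.univ.filter (fun l => (μ l : ℕ) ≠ 0)).card).choose i -
            if i = 0 then 0 else (k - (Finset.univ.filter (fun l => (μ l : ℕ) ≠ 0)).card).choose (i - 1))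
       else
         ∑ i ∈ Finset.range (k - (Finset.univ.filter (fun l => (μ l : ℕ) ≠ 0)).card -
             (((j + ∑ i, (μ i : ℕ)) / (e + 1) - (Finset.univ.filter (fun l => (μ l : ℕ) ≠ 0)).card) + (p - c)) + 1),
           if p ∣ (k - (Finset.univ.filter (fun l => (μ l : ℕ) ≠ 0)).card -
               ((j + ∑ i, (μ i : ℕ)) / (e + 1) - (Finset.univ.filter (fun l => (μ l : ℕ) ≠ 0)).card) - i).choose
               (k - (Finset.univ.filter (fun l => (μ l : ℕ) ≠ 0)).card -
                 (((j + ∑ i, (μ i : ℕ)) / (e + 1) - (Finset.univ.filter (fun l => (μ l : ℕ) ≠ 0)).card) + (p - c)) - i) then 0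
           else ((k - (Finset.univ.filter (fun l => (μ l : ℕ) ≠ 0)).card).choose i -
            if i = 0 then 0 else (k - (Finset.univ.filter (fun l => (μ l : ℕ) ≠ 0)).card).choose (i - 1)))
    else 0) =
    (if (e + 1) ∣ (j + (p - c) * (e + 1) + ∑ i, (μ i : ℕ)) ∧
      (e + 1) * (Finset.univ.filter (fun l => (μ l : ℕ) ≠ 0)).card ≤ j + (p - c) * (e + 1) + ∑ i, (μ i : ℕ) then
      (if p - c ≤ ((j + (p - c) * (e + 1) + ∑ i, (μ i : ℕ)) / (e + 1) - (Finset.univ.filter (fun l => (μ l : ℕ) ≠ 0)).card) then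
        (if k - (Finset.univ.filter (fun l => (μ l : ℕ) ≠ 0)).card <
            (((j + (p - c) * (e + 1) + ∑ i, (μ i : ℕ)) / (e + 1) - (Finset.univ.filter (fun l => (μ l : ℕ) ≠ 0)).card) - (p - c)) + (p - c) then 0
         else if (((j + (p - c) * (e + 1) + ∑ i, (μ i : ℕ)) / (e + 1) - (Finset.univ.filter (fun l => (μ l : ℕ) ≠ 0)).card) - (p - c)) +
            ((((j + (p - c) * (e + 1) + ∑ i, (μ i : ℕ)) / (e + 1) - (Finset.univ.filter (fun l => (μ l : ℕ) ≠ 0)).card) - (p - c)) + (p - c)) ≤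
            k - (Finset.univ.filter (fun l => (μ l : ℕ) ≠ 0)).card then
           ∑ i ∈ Finset.range ((((j + (p - c) * (e + 1) + ∑ i, (μ i : ℕ)) / (e + 1) - (Finset.univ.filter (fun l => (μ l : ℕ) ≠ 0)).card) - (p - c)) + 1),
             if p ∣ ((((j + (p - c) * (e + 1) + ∑ i, (μ i : ℕ)) / (e + 1) - (Finset.univ.filter (fun l => (μ l : ℕ) ≠ 0)).card) - (p - c)) + (p - c) - i).choose
                 ((((j + (p - c) * (e + 1) + ∑ i, (μ i : ℕ)) / (e + 1) - (Finset.univ.filter (fun l => (μ l : ℕ) ≠ 0)).card) - (p - c)) - i) then 0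
             else ((k - (Finset.univ.filter (fun l => (μ l : ℕ) ≠ 0)).card).choose i -
              if i = 0 then 0 else (k - (Finset.univ.filter (fun l => (μ l : ℕ) ≠ 0)).card).choose (i - 1))
         else
           ∑ i ∈ Finset.range (k - (Finset.univ.filter (fun l => (μ l : ℕ) ≠ 0)).card -
               ((((j + (p - c) * (e + 1) + ∑ i, (μ i : ℕ)) / (e + 1) - (Finset.univ.filter (fun l => (μ l : ℕ) ≠ 0)).card) - (p - c)) + (p - c)) + 1),
             if p ∣ (k - (Finset.univ.filter (fun l => (μ l : ℕ) ≠ 0)).card -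
                 (((j + (p - c) * (e + 1) + ∑ i, (μ i : ℕ)) / (e + 1) - (Finset.univ.filter (fun l => (μ l : ℕ) ≠ 0)).card) - (p - c)) - i).choose
                 (k - (Finset.univ.filter (fun l => (μ l : ℕ) ≠ 0)).card -
                   ((((j + (p - c) * (e + 1) + ∑ i, (μ i : ℕ)) / (e + 1) - (Finset.univ.filter (fun l => (μ l : ℕ) ≠ 0)).card) - (p - c)) + (p - c)) - i) then 0
             else ((k - (Finset.univ.filter (fun l => (μ l : ℕ) ≠ 0)).card).choose i -
              if i = 0 then 0 else (k - (Finset.univ.filter (fun l => (μ l : ℕ) ≠ 0)).card).choose (i - 1)))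
      else 0)
    else 0) := by
  have eJ : j + (p - c) * (e + 1) + ∑ i, (μ i : ℕ) = j + ∑ i, (μ i : ℕ) + (p - c) * (e + 1) := by ring
  have hTJ : (j + (p - c) * (e + 1) + ∑ i, (μ i : ℕ)) / (e + 1) = (j + ∑ i, (μ i : ℕ)) / (e + 1) + (p - c) := by
    rw [eJ, Nat.add_mul_div_right _ _ (Nat.succ_pos e)]
  by_cases hf : (e + 1) ∣ (j + (p - c) * (e + 1) + ∑ i, (μ i : ℕ)) ∧
      (e + 1) * (Finset.univ.filter (fun l => (μ l : ℕ) ≠ 0)).card ≤ j + (p - c) * (e + 1) + ∑ i, (μ i : ℕ)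
  · rw [if_pos hf]
    have hd : (e + 1) ∣ j + ∑ i, (μ i : ℕ) := by
      have h := Nat.dvd_sub hf.1 (dvd_mul_left (e + 1) (p - c))
      rwa [eJ, Nat.add_sub_cancel] at h
    have hD : (e + 1) * ((j + ∑ i, (μ i : ℕ)) / (e + 1)) = j + ∑ i, (μ i : ℕ) := Nat.mul_div_cancel' hd
    by_cases hin : p - c ≤ (j + (p - c) * (e + 1) + ∑ i, (μ i : ℕ)) / (e + 1) - (Finset.univ.filter (fun l => (μ l : ℕ) ≠ 0)).card
    · have hs : (e + 1) * (Finset.univ.filter (fun l => (μ l : ℕ) ≠ 0)).card ≤ j + ∑ i, (μ i : ℕ) := by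
        rw [← hD]
        exact Nat.mul_le_mul_left _ (by rw [hTJ] at hin; omega)
      rw [if_pos ⟨hd, hs⟩, if_pos hin]
      have ht : (j + ∑ i, (μ i : ℕ)) / (e + 1) - (Finset.univ.filter (fun l => (μ l : ℕ) ≠ 0)).card =
          (j + (p - c) * (e + 1) + ∑ i, (μ i : ℕ)) / (e + 1) - (Finset.univ.filter (fun l => (μ l : ℕ) ≠ 0)).card - (p - c) := by
        rw [hTJ]; omega
      rw [ht]
    · rw [if_neg hin, if_neg]
      rintro ⟨-, hs2⟩
      apply hin
      have hle : (Finset.univ.filter (fun l => (μ l : ℕ) ≠ 0)).card ≤ (j + ∑ i, (μ i : ℕ)) / (e + 1) :=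
        Nat.le_of_mul_le_mul_left (hs2.trans_eq hD.symm) (Nat.succ_pos e)
      rw [hTJ]; omega
  · rw [if_neg hf, if_neg]
    rintro ⟨hdj, hsj⟩
    apply hf
    refine ⟨?_, by omega⟩
    rw [eJ]
    exact dvd_add hdj (dvd_mul_left (e + 1) (p - c))

/-- (LABEL LAW) the block law for the label `μ` at codegree `J = j + (p−c)(e+1)`: anchor 294's summands of `×q^c` at `J` and of `×q^(p−c)`
at `j`, plus the windowed section at `t`, equal `[feasible]·C(k−s,t)` plus the windowed section at `t + c`. -/
theorem label_law {p c : ℕ} (hp : p.Prime) (hc : 0 < c) (hcp : c < p) (k e j : ℕ) (μ : Fin k → Fin (e + 1)) :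
    (if (e + 1) ∣ (j + (p - c) * (e + 1) + ∑ i, (μ i : ℕ)) ∧
      (e + 1) * (Finset.univ.filter (fun l => (μ l : ℕ) ≠ 0)).card ≤ j + (p - c) * (e + 1) + ∑ i, (μ i : ℕ) then
      (if k - (Finset.univ.filter (fun l => (μ l : ℕ) ≠ 0)).card <
          ((j + (p - c) * (e + 1) + ∑ i, (μ i : ℕ)) / (e + 1) - (Finset.univ.filter (fun l => (μ l : ℕ) ≠ 0)).card) + c then 0
       else if ((j + (p - c) * (e + 1) + ∑ i, (μ i : ℕ)) / (e + 1) - (Finset.univ.filter (fun l => (μ l : ℕ) ≠ 0)).card) +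
          (((j + (p - c) * (e + 1) + ∑ i, (μ i : ℕ)) / (e + 1) - (Finset.univ.filter (fun l => (μ l : ℕ) ≠ 0)).card) + c) ≤
          k - (Finset.univ.filter (fun l => (μ l : ℕ) ≠ 0)).card then
         ∑ i ∈ Finset.range (((j + (p - c) * (e + 1) + ∑ i, (μ i : ℕ)) / (e + 1) - (Finset.univ.filter (fun l => (μ l : ℕ) ≠ 0)).card) + 1),
           if p ∣ (((j + (p - c) * (e + 1) + ∑ i, (μ i : ℕ)) / (e + 1) - (Finset.univ.filter (fun l => (μ l : ℕ) ≠ 0)).card) + c - i).choose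
               (((j + (p - c) * (e + 1) + ∑ i, (μ i : ℕ)) / (e + 1) - (Finset.univ.filter (fun l => (μ l : ℕ) ≠ 0)).card) - i) then 0
           else ((k - (Finset.univ.filter (fun l => (μ l : ℕ) ≠ 0)).card).choose i -
            if i = 0 then 0 else (k - (Finset.univ.filter (fun l => (μ l : ℕ) ≠ 0)).card).choose (i - 1))
       else
         ∑ i ∈ Finset.range (k - (Finset.univ.filter (fun l => (μ l : ℕ) ≠ 0)).card -
             (((j + (p - c) * (e + 1) + ∑ i, (μ i : ℕ)) / (e + 1) - (Finset.univ.filter (fun l => (μ l : ℕ) ≠ 0)).card) + c) + 1),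
           if p ∣ (k - (Finset.univ.filter (fun l => (μ l : ℕ) ≠ 0)).card -
               ((j + (p - c) * (e + 1) + ∑ i, (μ i : ℕ)) / (e + 1) - (Finset.univ.filter (fun l => (μ l : ℕ) ≠ 0)).card) - i).choose
               (k - (Finset.univ.filter (fun l => (μ l : ℕ) ≠ 0)).card -
                 (((j + (p - c) * (e + 1) + ∑ i, (μ i : ℕ)) / (e + 1) - (Finset.univ.filter (fun l => (μ l : ℕ) ≠ 0)).card) + c) - i) then 0
           else ((k - (Finset.univ.filter (fun l => (μ l : ℕ) ≠ 0)).card).choose i -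
            if i = 0 then 0 else (k - (Finset.univ.filter (fun l => (μ l : ℕ) ≠ 0)).card).choose (i - 1)))
    else 0) +
    (if (e + 1) ∣ (j + ∑ i, (μ i : ℕ)) ∧
      (e + 1) * (Finset.univ.filter (fun l => (μ l : ℕ) ≠ 0)).card ≤ j + ∑ i, (μ i : ℕ) then
      (if k - (Finset.univ.filter (fun l => (μ l : ℕ) ≠ 0)).card <
          ((j + ∑ i, (μ i : ℕ)) / (e + 1) - (Finset.univ.filter (fun l => (μ l : ℕ) ≠ 0)).card) + (p - c) then 0
       else if ((j + ∑ i, (μ i : ℕ)) / (e + 1) - (Finset.univ.filter (fun l => (μ l : ℕ) ≠ 0)).card) +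
          (((j + ∑ i, (μ i : ℕ)) / (e + 1) - (Finset.univ.filter (fun l => (μ l : ℕ) ≠ 0)).card) + (p - c)) ≤
          k - (Finset.univ.filter (fun l => (μ l : ℕ) ≠ 0)).card then
         ∑ i ∈ Finset.range (((j + ∑ i, (μ i : ℕ)) / (e + 1) - (Finset.univ.filter (fun l => (μ l : ℕ) ≠ 0)).card) + 1),
           if p ∣ (((j + ∑ i, (μ i : ℕ)) / (e + 1) - (Finset.univ.filter (fun l => (μ l : ℕ) ≠ 0)).card) + (p - c) - i).choose
               (((j + ∑ i, (μ i : ℕ)) / (e + 1) - (Finset.univ.filter (fun l => (μ l : ℕ) ≠ 0)).card) - i) then 0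
           else ((k - (Finset.univ.filter (fun l => (μ l : ℕ) ≠ 0)).card).choose i -
            if i = 0 then 0 else (k - (Finset.univ.filter (fun l => (μ l : ℕ) ≠ 0)).card).choose (i - 1))
       else
         ∑ i ∈ Finset.range (k - (Finset.univ.filter (fun l => (μ l : ℕ) ≠ 0)).card -
             (((j + ∑ i, (μ i : ℕ)) / (e + 1) - (Finset.univ.filter (fun l => (μ l : ℕ) ≠ 0)).card) + (p - c)) + 1),
           if p ∣ (k - (Finset.univ.filter (fun l => (μ l : ℕ) ≠ 0)).card -
               ((j + ∑ i, (μ i : ℕ)) / (e + 1) - (Finset.univ.filter (fun l => (μ l : ℕ) ≠ 0)).card) - i).choose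
               (k - (Finset.univ.filter (fun l => (μ l : ℕ) ≠ 0)).card -
                 (((j + ∑ i, (μ i : ℕ)) / (e + 1) - (Finset.univ.filter (fun l => (μ l : ℕ) ≠ 0)).card) + (p - c)) - i) then 0
           else ((k - (Finset.univ.filter (fun l => (μ l : ℕ) ≠ 0)).card).choose i -
            if i = 0 then 0 else (k - (Finset.univ.filter (fun l => (μ l : ℕ) ≠ 0)).card).choose (i - 1)))
    else 0) +
    (if (e + 1) ∣ (j + (p - c) * (e + 1) + ∑ i, (μ i : ℕ)) ∧
      (e + 1) * (Finset.univ.filter (fun l => (μ l : ℕ) ≠ 0)).card ≤ j + (p - c) * (e + 1) + ∑ i, (μ i : ℕ) then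
      (if 2 * ((j + (p - c) * (e + 1) + ∑ i, (μ i : ℕ)) / (e + 1) - (Finset.univ.filter (fun l => (μ l : ℕ) ≠ 0)).card) ≤
          k - (Finset.univ.filter (fun l => (μ l : ℕ) ≠ 0)).card + (p - c) ∧
        k - (Finset.univ.filter (fun l => (μ l : ℕ) ≠ 0)).card <
          2 * ((j + (p - c) * (e + 1) + ∑ i, (μ i : ℕ)) / (e + 1) - (Finset.univ.filter (fun l => (μ l : ℕ) ≠ 0)).card) + c then
        ((∑ b ∈ Finset.range (((j + (p - c) * (e + 1) + ∑ i, (μ i : ℕ)) / (e + 1) - (Finset.univ.filter (fun l => (μ l : ℕ) ≠ 0)).card) / p),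
            (k - (Finset.univ.filter (fun l => (μ l : ℕ) ≠ 0)).card).choose
              (((j + (p - c) * (e + 1) + ∑ i, (μ i : ℕ)) / (e + 1) - (Finset.univ.filter (fun l => (μ l : ℕ) ≠ 0)).card) - (b + 1) * p)) +
          (k - (Finset.univ.filter (fun l => (μ l : ℕ) ≠ 0)).card).choose
            ((j + (p - c) * (e + 1) + ∑ i, (μ i : ℕ)) / (e + 1) - (Finset.univ.filter (fun l => (μ l : ℕ) ≠ 0)).card) +
          (∑ b ∈ Finset.range ((k - (Finset.univ.filter (fun l => (μ l : ℕ) ≠ 0)).card -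
              ((j + (p - c) * (e + 1) + ∑ i, (μ i : ℕ)) / (e + 1) - (Finset.univ.filter (fun l => (μ l : ℕ) ≠ 0)).card)) / p),
            (k - (Finset.univ.filter (fun l => (μ l : ℕ) ≠ 0)).card).choose
              (((j + (p - c) * (e + 1) + ∑ i, (μ i : ℕ)) / (e + 1) - (Finset.univ.filter (fun l => (μ l : ℕ) ≠ 0)).card) + (b + 1) * p)))
      else 0)
    else 0) =
    (if (e + 1) ∣ (j + (p - c) * (e + 1) + ∑ i, (μ i : ℕ)) ∧
      (e + 1) * (Finset.univ.filter (fun l => (μ l : ℕ) ≠ 0)).card ≤ j + (p - c) * (e + 1) + ∑ i, (μ i : ℕ) then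
      (k - (Finset.univ.filter (fun l => (μ l : ℕ) ≠ 0)).card).choose
        ((j + (p - c) * (e + 1) + ∑ i, (μ i : ℕ)) / (e + 1) - (Finset.univ.filter (fun l => (μ l : ℕ) ≠ 0)).card)
    else 0) +
    (if (e + 1) ∣ (j + (p - c) * (e + 1) + ∑ i, (μ i : ℕ)) ∧
      (e + 1) * (Finset.univ.filter (fun l => (μ l : ℕ) ≠ 0)).card ≤ j + (p - c) * (e + 1) + ∑ i, (μ i : ℕ) then
      (if 2 * ((j + (p - c) * (e + 1) + ∑ i, (μ i : ℕ)) / (e + 1) - (Finset.univ.filter (fun l => (μ l : ℕ) ≠ 0)).card) ≤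
          k - (Finset.univ.filter (fun l => (μ l : ℕ) ≠ 0)).card + (p - c) ∧
        k - (Finset.univ.filter (fun l => (μ l : ℕ) ≠ 0)).card <
          2 * ((j + (p - c) * (e + 1) + ∑ i, (μ i : ℕ)) / (e + 1) - (Finset.univ.filter (fun l => (μ l : ℕ) ≠ 0)).card) + c then
        ((∑ b ∈ Finset.range ((((j + (p - c) * (e + 1) + ∑ i, (μ i : ℕ)) / (e + 1) - (Finset.univ.filter (fun l => (μ l : ℕ) ≠ 0)).card) + c) / p),
            (k - (Finset.univ.filter (fun l => (μ l : ℕ) ≠ 0)).card).choose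
              ((((j + (p - c) * (e + 1) + ∑ i, (μ i : ℕ)) / (e + 1) - (Finset.univ.filter (fun l => (μ l : ℕ) ≠ 0)).card) + c) - (b + 1) * p)) +
          (k - (Finset.univ.filter (fun l => (μ l : ℕ) ≠ 0)).card).choose
            (((j + (p - c) * (e + 1) + ∑ i, (μ i : ℕ)) / (e + 1) - (Finset.univ.filter (fun l => (μ l : ℕ) ≠ 0)).card) + c) +
          (∑ b ∈ Finset.range ((k - (Finset.univ.filter (fun l => (μ l : ℕ) ≠ 0)).card -
              (((j + (p - c) * (e + 1) + ∑ i, (μ i : ℕ)) / (e + 1) - (Finset.univ.filter (fun l => (μ l : ℕ) ≠ 0)).card) + c)) / p),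
            (k - (Finset.univ.filter (fun l => (μ l : ℕ) ≠ 0)).card).choose
              ((((j + (p - c) * (e + 1) + ∑ i, (μ i : ℕ)) / (e + 1) - (Finset.univ.filter (fun l => (μ l : ℕ) ≠ 0)).card) + c) + (b + 1) * p)))
      else 0)
    else 0) := by
  rw [in_summand_eq p k e c j μ hcp]
  by_cases hf : (e + 1) ∣ (j + (p - c) * (e + 1) + ∑ i, (μ i : ℕ)) ∧
      (e + 1) * (Finset.univ.filter (fun l => (μ l : ℕ) ≠ 0)).card ≤ j + (p - c) * (e + 1) + ∑ i, (μ i : ℕ)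
  · rw [if_pos hf, if_pos hf, if_pos hf, if_pos hf, if_pos hf]
    exact block_law hp hc hcp (k - (Finset.univ.filter (fun l => (μ l : ℕ) ≠ 0)).card)
      ((j + (p - c) * (e + 1) + ∑ i, (μ i : ℕ)) / (e + 1) - (Finset.univ.filter (fun l => (μ l : ℕ) ≠ 0)).card)
  · rw [if_neg hf, if_neg hf, if_neg hf, if_neg hf, if_neg hf]

/-! ## §2 the census Betti number -/

/-- the row space of a matrix over a field has dimension its rank (`rank = rank of the transpose`). -/
theorem finrank_range_vecMulLinear_eq_rank (K : Type*) [Field K] {m n : Type*} [Fintype m] [Fintype n] [DecidableEq m] [DecidableEq n]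
    (A : Matrix m n K) : Module.finrank K (LinearMap.range (Matrix.vecMulLinear A)) = A.rank := by
  rw [← Matrix.mulVecLin_transpose, ← Matrix.rank_transpose]
  rfl

/-- **(CENSUS BETTI) THE HOMOLOGY OF THE `q`-LADDER OF THE CENSUS AT EVERY CODEGREE.**  Over a field `K` of prime characteristic `p > c ≥ 1`,
for anchor 229's multiplicity matrices of `×q^c` at codegree `J = j + (p−c)(e+1)` and of `×q^(p−c)` at codegree `j` (VERBATIM; the second maps
INTO the row space of the first, and `×q^(p−c) · ×q^c = ×q^p ≡ 0`):
`dim leftker (×q^c at J) + Σ_μ [feasible ∧ window] S_p(k−s, t+c) = dim rowspace (×q^(p−c) at j) + Σ_μ [feasible ∧ window] S_p(k−s, t)`,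
`t = (J+Σμ)/(e+1) − s`, window `2t ≤ k − s + (p−c) ∧ k − s < 2t + c`, both `p`-sections in pieces — i.e. the Betti number
`dim leftker − dim rowspace` of the ladder at `J` is the label sum of the section differences `S_p(k−s,t) − S_p(k−s,t+c) ≥ 0` over the labels
whose block sits in its window, and in particular `0` at every codegree where no feasible label is in its window (PROBE 27 (EX)). -/
theorem finrank_ker_add_eq (K : Type*) [Field K] (p : ℕ) [CharP K p] (hp : p.Prime) (k e c j : ℕ) (hc : 0 < c) (hcp : c < p) :
    Module.finrank K (LinearMap.ker (Matrix.vecMulLinear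
      (Matrix.of fun (v : {v : Fin k → Fin (e + 2) // (∑ i, (v i : ℕ)) + (j + (p - c) * (e + 1)) = k * (e + 1)})
          (m : {m : Fin k → Fin (e + 2) // (∑ i, (m i : ℕ)) + (j + (p - c) * (e + 1) + c * (e + 1)) = k * (e + 1)}) =>
        ((((List.flatMap (colR (e + 3)))^[c] [List.ofFn (fun i => (m.1 i : ℕ))]).count (List.ofFn (fun i => (v.1 i : ℕ))) : ℕ) : K)))) +
      ∑ μ : Fin k → Fin (e + 1),
        (if (e + 1) ∣ (j + (p - c) * (e + 1) + ∑ i, (μ i : ℕ)) ∧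
          (e + 1) * (Finset.univ.filter (fun l => (μ l : ℕ) ≠ 0)).card ≤ j + (p - c) * (e + 1) + ∑ i, (μ i : ℕ) then
          (if 2 * ((j + (p - c) * (e + 1) + ∑ i, (μ i : ℕ)) / (e + 1) - (Finset.univ.filter (fun l => (μ l : ℕ) ≠ 0)).card) ≤
              k - (Finset.univ.filter (fun l => (μ l : ℕ) ≠ 0)).card + (p - c) ∧
            k - (Finset.univ.filter (fun l => (μ l : ℕ) ≠ 0)).card <
              2 * ((j + (p - c) * (e + 1) + ∑ i, (μ i : ℕ)) / (e + 1) - (Finset.univ.filter (fun l => (μ l : ℕ) ≠ 0)).card) + c then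
            ((∑ b ∈ Finset.range ((((j + (p - c) * (e + 1) + ∑ i, (μ i : ℕ)) / (e + 1) - (Finset.univ.filter (fun l => (μ l : ℕ) ≠ 0)).card) + c) / p),
                (k - (Finset.univ.filter (fun l => (μ l : ℕ) ≠ 0)).card).choose
                  ((((j + (p - c) * (e + 1) + ∑ i, (μ i : ℕ)) / (e + 1) - (Finset.univ.filter (fun l => (μ l : ℕ) ≠ 0)).card) + c) - (b + 1) * p)) +
              (k - (Finset.univ.filter (fun l => (μ l : ℕ) ≠ 0)).card).choose
                (((j + (p - c) * (e + 1) + ∑ i, (μ i : ℕ)) / (e + 1) - (Finset.univ.filter (fun l => (μ l : ℕ) ≠ 0)).card) + c) +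
              (∑ b ∈ Finset.range ((k - (Finset.univ.filter (fun l => (μ l : ℕ) ≠ 0)).card -
                  (((j + (p - c) * (e + 1) + ∑ i, (μ i : ℕ)) / (e + 1) - (Finset.univ.filter (fun l => (μ l : ℕ) ≠ 0)).card) + c)) / p),
                (k - (Finset.univ.filter (fun l => (μ l : ℕ) ≠ 0)).card).choose
                  ((((j + (p - c) * (e + 1) + ∑ i, (μ i : ℕ)) / (e + 1) - (Finset.univ.filter (fun l => (μ l : ℕ) ≠ 0)).card) + c) + (b + 1) * p)))
          else 0)
        else 0) =
    Module.finrank K (LinearMap.range (Matrix.vecMulLinear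
      (Matrix.of fun (v : {v : Fin k → Fin (e + 2) // (∑ i, (v i : ℕ)) + j = k * (e + 1)})
          (m : {v : Fin k → Fin (e + 2) // (∑ i, (v i : ℕ)) + (j + (p - c) * (e + 1)) = k * (e + 1)}) =>
        ((((List.flatMap (colR (e + 3)))^[p - c] [List.ofFn (fun i => (m.1 i : ℕ))]).count (List.ofFn (fun i => (v.1 i : ℕ))) : ℕ) : K)))) +
      ∑ μ : Fin k → Fin (e + 1),
        (if (e + 1) ∣ (j + (p - c) * (e + 1) + ∑ i, (μ i : ℕ)) ∧
          (e + 1) * (Finset.univ.filter (fun l => (μ l : ℕ) ≠ 0)).card ≤ j + (p - c) * (e + 1) + ∑ i, (μ i : ℕ) then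
          (if 2 * ((j + (p - c) * (e + 1) + ∑ i, (μ i : ℕ)) / (e + 1) - (Finset.univ.filter (fun l => (μ l : ℕ) ≠ 0)).card) ≤
              k - (Finset.univ.filter (fun l => (μ l : ℕ) ≠ 0)).card + (p - c) ∧
            k - (Finset.univ.filter (fun l => (μ l : ℕ) ≠ 0)).card <
              2 * ((j + (p - c) * (e + 1) + ∑ i, (μ i : ℕ)) / (e + 1) - (Finset.univ.filter (fun l => (μ l : ℕ) ≠ 0)).card) + c then
            ((∑ b ∈ Finset.range (((j + (p - c) * (e + 1) + ∑ i, (μ i : ℕ)) / (e + 1) - (Finset.univ.filter (fun l => (μ l : ℕ) ≠ 0)).card) / p),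
                (k - (Finset.univ.filter (fun l => (μ l : ℕ) ≠ 0)).card).choose
                  (((j + (p - c) * (e + 1) + ∑ i, (μ i : ℕ)) / (e + 1) - (Finset.univ.filter (fun l => (μ l : ℕ) ≠ 0)).card) - (b + 1) * p)) +
              (k - (Finset.univ.filter (fun l => (μ l : ℕ) ≠ 0)).card).choose
                ((j + (p - c) * (e + 1) + ∑ i, (μ i : ℕ)) / (e + 1) - (Finset.univ.filter (fun l => (μ l : ℕ) ≠ 0)).card) +
              (∑ b ∈ Finset.range ((k - (Finset.univ.filter (fun l => (μ l : ℕ) ≠ 0)).card -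
                  ((j + (p - c) * (e + 1) + ∑ i, (μ i : ℕ)) / (e + 1) - (Finset.univ.filter (fun l => (μ l : ℕ) ≠ 0)).card)) / p),
                (k - (Finset.univ.filter (fun l => (μ l : ℕ) ≠ 0)).card).choose
                  (((j + (p - c) * (e + 1) + ∑ i, (μ i : ℕ)) / (e + 1) - (Finset.univ.filter (fun l => (μ l : ℕ) ≠ 0)).card) + (b + 1) * p)))
          else 0)
        else 0) := by
  classical
  have h1 := LinearMap.finrank_range_add_finrank_ker (Matrix.vecMulLinear
    (Matrix.of fun (v : {v : Fin k → Fin (e + 2) // (∑ i, (v i : ℕ)) + (j + (p - c) * (e + 1)) = k * (e + 1)})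
          (m : {m : Fin k → Fin (e + 2) // (∑ i, (m i : ℕ)) + (j + (p - c) * (e + 1) + c * (e + 1)) = k * (e + 1)}) =>
        ((((List.flatMap (colR (e + 3)))^[c] [List.ofFn (fun i => (m.1 i : ℕ))]).count (List.ofFn (fun i => (v.1 i : ℕ))) : ℕ) : K)))
  rw [Module.finrank_fintype_fun_eq_card, finrank_range_vecMulLinear_eq_rank, card_eq_sum k e (j + (p - c) * (e + 1)),
    rank_mulDeltaPow_levels_eq_sum_wilson K p k e c (j + (p - c) * (e + 1)) (cast_factorial_ne_zero K p hp c hcp)] at h1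
  rw [finrank_range_vecMulLinear_eq_rank,
    rank_mulDeltaPow_levels_eq_sum_wilson K p k e (p - c) j (cast_factorial_ne_zero K p hp (p - c) (by omega))]
  have h2 := Finset.sum_congr rfl (fun (μ : Fin k → Fin (e + 1)) (_ : μ ∈ Finset.univ) => label_law hp hc hcp k e j μ)
  rw [Finset.sum_add_distrib, Finset.sum_add_distrib, Finset.sum_add_distrib] at h2
  omega

end Summit.HodgeConjecture.HodgeConjecture.HodgeLocus.Census.UnitColumnBetti
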